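import Mathlib
import Summits.ResolutionOfSingularities.ResolutionOfSingularities.Theorems.HomologicalConductorNoZenoSplitModelLocal
import HarnessLib

/-!
# D2′ part 2b-ii (complement): a prime of the split model over `P` exists

W4.4 (crux `NoZenoR`, stmt-ResolutionOfSingularities-19943), `stub_L1wCore` route (F1), upstairs
thread data. In the setting of `…NoZenoSplitModelLocal` (split model `T_f ⊆ K_f` of
`exists_splitModel`, germ `D = T_P`, `f` with irreducible reduction modulo `𝔪_D`), the ideal
`𝔓 := e(θ⁻¹(𝔪_{D[X]/(f_D)}))` is a prime of `T_f` lying over `P`; together with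
`exists_ringEquiv_locPrime_adjoinRoot` this supplies the pair `(T_f, 𝔓)` on which the thread-free
core `Sig.L1Core` is instantiated upstairs. Everything is PROVED.

OURS (cell res-hironaka, chain W4.4); AI-written, weaker than expert review; nothing here is a
statement of the manuscript under review.
-/

noncomputable section

set_option linter.dupNamespace false

open IsLocalRing Polynomial
open Summit.ResolutionOfSingularities.ResolutionOfSingularities.Theorems.NoZeno.SandwichCluster
open Summit.ResolutionOfSingularities.ResolutionOfSingularities.Theorems.NoZeno.SandwichCluster.Parasite
  (locPrime mem_locPrime_iff mem_locPrime_of_mem inv_mem_locPrime_of_not_mem)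

namespace Summit.ResolutionOfSingularities.ResolutionOfSingularities.Theorems.NoZeno.SplittingBase

variable {k K : Type} [Field k] [Field K] [Algebra k K]

section PrimeOver

variable (T : Subalgebra k K) (P : Ideal ↥T) (hP : P.IsPrime) (f : (↥T)[X]) (hf : f.Monic)
  [Fact (Irreducible (f.map (algebraMap ↥T K)))]
  (Tf : Subalgebra k (AdjoinRoot (f.map (algebraMap ↥T K))))
  (e : AdjoinRoot f ≃ₐ[k] ↥Tf)

include hf in
/-- **A prime of the model over `P` exists**: `𝔓 := e(θ⁻¹(𝔪_{B_D}))` (irreducible reduction, so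
`B_D = D[X]/(f_D)` is local) is a prime ideal of `T_f` lying over `P` in the sense of `hover`.
[this work] -/
theorem exists_prime_over
    (hirr : Irreducible ((mapGerm T P hP f).map (residue ↥(locPrimeSubalgebra T P hP)))) :
    ∃ (𝔓 : Ideal ↥Tf) (_ : 𝔓.IsPrime), ∀ t : ↥T, e (AdjoinRoot.of f t) ∈ 𝔓 ↔ t ∈ P := by
  obtain ⟨hloc, hlh, hmB⟩ := adjoinRoot_isLocalRing_of_irreducible (monic_mapGerm T P hP f hf) hirr
  let 𝔮 : Ideal (AdjoinRoot f) := (maximalIdeal (AdjoinRoot (mapGerm T P hP f))).comap (toGerm T P hP f)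
  haveI : 𝔮.IsPrime := Ideal.comap_isPrime _ _
  let 𝔓 : Ideal ↥Tf := 𝔮.comap (e.symm : ↥Tf →+* AdjoinRoot f)
  refine ⟨𝔓, Ideal.comap_isPrime _ _, fun t => ?_⟩
  show e.symm (e (AdjoinRoot.of f t)) ∈ 𝔮 ↔ t ∈ P
  rw [AlgEquiv.symm_apply_apply]
  show toGerm T P hP f (AdjoinRoot.of f t) ∈ maximalIdeal _ ↔ t ∈ P
  rw [toGerm, AdjoinRoot.lift_of, RingHom.comp_apply, ← AdjoinRoot.algebraMap_eq,
    IsLocalRing.mem_maximalIdeal, mem_nonunits_iff, isUnit_map_iff (algebraMap _ _)]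
  -- `t` is a unit of the germ `D = T_P` iff `t ∉ P`
  constructor
  · intro hnu
    by_contra htP
    apply hnu
    have ht0 : (t : K) ≠ 0 := Parasite.ne_zero_of_not_mem_ideal T P t.2 (by simpa using htP)
    have hinv : (t : K)⁻¹ ∈ locPrime T P hP :=
      inv_mem_locPrime_of_not_mem T P hP t.2 (by simpa using htP)
    exact ⟨⟨_, ⟨(t : K)⁻¹, hinv⟩, Subtype.ext (mul_inv_cancel₀ ht0),
      Subtype.ext (inv_mul_cancel₀ ht0)⟩, rfl⟩
  · intro htP hunit
    by_cases ht0 : (t : K) = 0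
    · have : ((Subalgebra.inclusion (le_locPrimeSubalgebra T P hP)).toRingHom t :
          ↥(locPrimeSubalgebra T P hP)) = 0 := Subtype.ext ht0
      rw [this, isUnit_zero_iff] at hunit
      exact zero_ne_one hunit
    · obtain ⟨v, hv⟩ := hunit.exists_right_inv
      have hvK : (v : K) = (t : K)⁻¹ := by
        have := congrArg (fun z : ↥(locPrimeSubalgebra T P hP) => (z : K)) hv
        exact eq_inv_of_mul_eq_one_right this
      exact Parasite.inv_not_mem_locPrime_of_mem T P hP t.2 (by simpa using htP) ht0 (hvK ▸ v.2)

end PrimeOver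

/-! ## The local-étale bundle for a GIVEN splitting polynomial

BC-0's bundle (`exists_adjoinRoot_localEtale_bundle`) is existential in `f`; upstairs the polynomial
is fixed, so we also record the bundle for a given monic `f` with irreducible separable reduction —
this is what transfers to the upstairs germ along `exists_ringEquiv_locPrime_adjoinRoot`. -/

/-- **Local-étale bundle for a given `f`.** Over a Noetherian local ring `A`, if `f` is monic with
irreducible and separable reduction, then `B := A[X]/(f)` is a Noetherian local ring, `A → B` is a
local homomorphism, flat, formally unramified, essentially of finite type, `𝔪_A·B = 𝔪_B`,
`κ_B/κ_A` finite separable, `dim B = dim A`, and `B` is regular iff `A` is. [folklore] -/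
theorem adjoinRoot_localEtale_bundle_of_irreducible {A : Type} [CommRing A] [IsLocalRing A]
    [IsNoetherianRing A] {f : A[X]} (hf : f.Monic) (hirr : Irreducible (f.map (residue A)))
    (hsep : (f.map (residue A)).Separable) :
    ∃ (_ : IsLocalRing (AdjoinRoot f)) (_ : IsLocalHom (algebraMap A (AdjoinRoot f))),
      IsNoetherianRing (AdjoinRoot f) ∧ Module.Flat A (AdjoinRoot f) ∧
      Algebra.FormallyUnramified A (AdjoinRoot f) ∧ Algebra.EssFiniteType A (AdjoinRoot f) ∧
      (maximalIdeal A).map (algebraMap A (AdjoinRoot f)) = maximalIdeal (AdjoinRoot f) ∧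
      Algebra.IsSeparable (ResidueField A) (ResidueField (AdjoinRoot f)) ∧
      Module.Finite (ResidueField A) (ResidueField (AdjoinRoot f)) ∧
      ringKrullDim (AdjoinRoot f) = ringKrullDim A ∧
      (IsRegularLocalRing (AdjoinRoot f) ↔ IsRegularLocalRing A) := by
  obtain ⟨hloc, hlh, hmB⟩ := adjoinRoot_isLocalRing_of_irreducible hf hirr
  haveI := hloc; haveI := hlh
  haveI : Module.Free A (AdjoinRoot f) := hf.free_adjoinRoot
  haveI : Module.Finite A (AdjoinRoot f) := hf.finite_adjoinRoot
  haveI : Algebra.IsStandardEtale A (AdjoinRoot f) := isStandardEtale_adjoinRoot_of_separable_map hf hsep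
  haveI : Algebra.Etale A (AdjoinRoot f) := inferInstance
  haveI hN : IsNoetherianRing (AdjoinRoot f) := IsNoetherianRing.of_finite A (AdjoinRoot f)
  haveI hfl : Module.Flat A (AdjoinRoot f) := inferInstance
  haveI hur : Algebra.FormallyUnramified A (AdjoinRoot f) := inferInstance
  haveI heft : Algebra.EssFiniteType A (AdjoinRoot f) := inferInstance
  exact ⟨hloc, hlh, hN, hfl, hur, heft, hmB, inferInstance, inferInstance,
    Literature.AlgebraicGeometry.Resolution.ringKrullDim_eq_of_etaleLocal A (AdjoinRoot f),
    Literature.AlgebraicGeometry.Resolution.isRegularLocalRing_iff_of_etaleLocal A (AdjoinRoot f)⟩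

end Summit.ResolutionOfSingularities.ResolutionOfSingularities.Theorems.NoZeno.SplittingBase

end
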